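import Summits.BirchSwinnertonDyer.Rank1Residual.X5.TwoAdicInstances158774g
import HarnessLib

/-!
# X5 at `p = 2` (cell `bsd-2adic`, seat `bsd-2adic-mult`, GEN 3): the NON-SPLIT ANCHOR references of door
# (34-GV-mult), part A — 30a1, 46a1, 142c1 (and `14a1`, in `TwoAdicInstances158774g.lean`)

HONEST FRAMING (cell `bsd-2adic`, run/shared/lean/pub/bsd-2adic/, D-0036 / D-0054; memo
`HOME/mult/PROOF-GVMULT.md` + ADDENDUM-1): every anchor `A` here is a Cremona curve with `2 ‖ N_A`,
NON-SPLIT multiplicative at `2`, squarefree conductor with `LAW(N_A) = 0`, negative discriminant and ONE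
rational point of order `2` (integral abscissa, Greenberg type B — a Prop-5.14 point); its cyclotomic
invariants `(torsion, μ = 0, λ = 0)` come from GEN-2's `anchor_invariants_of_prop514_nonsplit` given
the displayed K11a at `A`, `hper₀` and the certificates `λ_an(A) = 0`, `μ_an(A) = 0` (STEP-0 GVM kit
j244761: `(μ, λ)_an = (0, 0)` at 30a, 46a, 78a, 142c, 174d, 206a, 1454a). This file only DECIDES
THE CURVE DATA (minimality, ellipticity, multiplicative non-split reduction at `2`, conductor, the unique
type-B `2`-torsion point, `2 ∣ #Ẽ(𝔽_ℓ)` at good odd `ℓ`) for use by the per-class target files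
`TwoAdicInstancesGVM<class>.lean`. Nothing asserted beyond kernel-decided arithmetic; nothing booked.
References: [SilvermanAEC2009] VII.1.1, VII.5.1, VII.3.1; [Silverman1994] IV.10.2; [CremonaAlgorithms1997] Table 1.
-/

set_option autoImplicit false

open IsDedekindDomain WeierstrassCurve Literature.NumberTheory.EllipticCurves
  Literature.NumberTheory.EllipticCurves.ModularForms
  Literature.NumberTheory.EllipticCurves.Rank1Residual
  Literature.NumberTheory.EllipticCurves.Rank1Residual.Typed
  Literature.NumberTheory.EllipticCurves.Greenberg1999
  Literature.NumberTheory.EllipticCurves.PolyCert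
  Summit.BirchSwinnertonDyer.Rank1Residual.X1.MuPart
  Summit.BirchSwinnertonDyer.Rank1Residual.X1.ParitySqueeze
  Summit.BirchSwinnertonDyer.Rank1Residual.X5.O1

open CongruenceSubgroup
open scoped MatrixGroups ModularForm

namespace Summit.BirchSwinnertonDyer.Rank1Residual.X5.Instances

/-- `padicValNat 2 (2^k · r) = k` for odd `r` (bookkeeping for Matsuno's `n_ℓ = ord₂((ℓ²−1)/8)`). [folklore] -/
theorem padicValNat_two_of_eq {m : ℕ} (k r : ℕ) (h : m = 2 ^ k * r) (hr : ¬ 2 ∣ r) :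
    padicValNat 2 m = k := by
  have hr0 : r ≠ 0 := by rintro rfl; exact hr (dvd_zero 2)
  rw [h, padicValNat.mul (by positivity) hr0, padicValNat.prime_pow, padicValNat.eq_zero_of_not_dvd hr,
    add_zero]

/-- Cremona `30a1` = `[1, 0, 1, 1, 2]` (integer model). [cite: CremonaAlgorithms1997, Table 1] -/
abbrev M30a1 : WeierstrassCurve ℤ := ⟨1, 0, 1, 1, 2⟩
/-- `30a1 / ℚ`. [cite: CremonaAlgorithms1997, Table 1] -/
abbrev c30a1 : WeierstrassCurve ℚ := M30a1.baseChange ℚ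
/-- `Δ(30a1)` (factorisation `{2: 4, 3: 3, 5: 1}`, negative). [cite: CremonaAlgorithms1997, Table 1] -/
theorem M30a1_Δ : M30a1.Δ = -2160 := by decide
/-- `c₄(30a1)` (coprime to `Δ`: semistable model). [cite: CremonaAlgorithms1997, Table 1] -/
theorem M30a1_c₄ : M30a1.c₄ = -71 := by decide
/-- `30a1` is an elliptic curve. [cite: CremonaAlgorithms1997, Table 1] -/
instance c30a1_isElliptic : c30a1.IsElliptic := by
  rw [WeierstrassCurve.isElliptic_iff, baseChange_int_Δ, M30a1_Δ]; norm_num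
/-- Cremona's model `30a1` is globally minimal (`gcd(Δ, c₄) = 1`). [cite: SilvermanAEC2009, VII.1 Remark 1.1] -/
instance c30a1_isGloballyMinimal : c30a1.IsGloballyMinimal :=
  isGloballyMinimal_baseChange_int_of_gcd_eq_one 1 0 1 1 2 (by decide)
/-- `Δ(30a1)`, `c₄(30a1)` coprime. [cite: SilvermanAEC2009, VII.5 Prop. 5.1(b)] -/
theorem M30a1_coprime : IsCoprime M30a1.Δ M30a1.c₄ := by
  rw [M30a1_Δ, M30a1_c₄, Int.isCoprime_iff_gcd_eq_one]; decide
/-- **`30a1` is multiplicative at `2`** (`2 ∣ Δ`, `2 ∤ c₄`). [cite: SilvermanAEC2009, VII.5 Prop. 5.1(b)] -/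
theorem mult_two_30a1 : Mult c30a1 2 := by
  have hgen : Rat.HeightOneSpectrum.natGenerator
      ((Rat.HeightOneSpectrum.primesEquiv (R := ℤ)).symm ⟨2, Nat.prime_two⟩) = 2 :=
    Literature.NumberTheory.EllipticCurves.Rat.natGenerator_primesEquiv_symm ⟨2, Nat.prime_two⟩
  have hm := hasMultiplicativeReductionAt_baseChange_int_of_isCoprime M30a1 M30a1_coprime
    (v := (Rat.HeightOneSpectrum.primesEquiv (R := ℤ)).symm ⟨2, Nat.prime_two⟩)
    (by rw [hgen, M30a1_Δ]; decide)
  exact (hasMultiplicativeReductionAtPrime_iff_hasMultiplicativeReductionAt_holds c30a1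
    ⟨2, Nat.prime_two⟩).mpr hm
/-- `30a1 mod 2`. [folklore] -/
theorem M30a1_mod_two : M30a1.map (Int.castRingHom (ZMod 2)) = ⟨1, 0, 1, 1, 0⟩ := by
  ext <;> decide
/-- **`30a1` is NON-SPLIT multiplicative at `2`** (node quadratic `X² + X + 1` has no root in `𝔽₂`).
[cite: SilvermanAEC2009, VII.5 Prop. 5.1(b)] -/
theorem not_split_two_30a1 : ¬ c30a1.HasSplitMultiplicativeReductionAtPrime 2 := by
  have hint : integralModelInt c30a1 = M30a1 := integralModelInt_baseChange_int M30a1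
  have hΔ : ((2 : ℕ) : ℤ) ∣ (integralModelInt c30a1).Δ := by rw [hint, M30a1_Δ]; decide
  have hc₄ : ¬ ((2 : ℕ) : ℤ) ∣ (integralModelInt c30a1).c₄ := by rw [hint, M30a1_c₄]; decide
  rw [LocalTorsionMult.hasSplitMultiplicativeReductionAtPrime_iff_splits_integralModelInt c30a1 2 hΔ
    hc₄, hint, M30a1_mod_two]
  dsimp only
  rw [sub_eq_add_neg, ← Polynomial.C_neg]
  exact not_splits_quadratic_F2 (by decide) (by decide) (by decide)
/-- **The conductor of `30a1` is `30`** (semistable; Silverman ATAEC IV.10.2). [cite: CremonaAlgorithms1997, Table 1] -/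
theorem conductorNorm_30a1 : c30a1.conductorNorm ℤ = 30 := by
  refine conductorNorm_baseChange_int_of_isCoprime M30a1 M30a1_coprime (k := 4) ?_ ?_ ?_
  · rw [Nat.squarefree_iff_nodup_primeFactorsList (by norm_num)]; simp
  · rw [M30a1_Δ]; decide
  · rw [M30a1_Δ]; decide
/-- The coefficients of `30a1 / ℚ` (unfolded). [cite: CremonaAlgorithms1997, Table 1] -/
theorem c30a1_eq : c30a1 = ⟨1, 0, 1, 1, 2⟩ := by
  rw [c30a1, baseChange_int_eq]; norm_num
/-- `b₂, b₄, b₆` of `30a1`; `2`-division cubic `= (x − (-1))(4x² + (-3)x + (9))`. [cite: SilvermanAEC2009, III.1] -/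
theorem c30a1_b : c30a1.b₂ = 1 ∧ c30a1.b₄ = 3 ∧ c30a1.b₆ = 9 := by
  rw [c30a1_eq]
  simp only [WeierstrassCurve.b₂, WeierstrassCurve.b₄, WeierstrassCurve.b₆]
  norm_num
/-- The rational point `(-1, 0)` of order `2` on `30a1`. [cite: CremonaAlgorithms1997, Table 1] -/
theorem c30a1_P : c30a1.toAffine.Equation (-1) 0 ∧
    2 * (0 : ℚ) + c30a1.a₁ * (-1) + c30a1.a₃ = 0 := by
  rw [c30a1_eq, WeierstrassCurve.Affine.equation_iff]; norm_num
/-- **`(-1, 0)` is the ONLY rational point of order `2` on `30a1`** (cofactor of negative discriminant).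
[cite: SilvermanAEC2009, III.2.3] -/
theorem c30a1_unique : HasUniqueRationalTwoTorsionX c30a1 (-1) := by
  refine ⟨⟨0, c30a1_P⟩, fun z hz ↦ ?_⟩
  have hc := cubic_eq_zero_of_hasRationalTwoTorsionX hz
  obtain ⟨hb₂, hb₄, hb₆⟩ := c30a1_b
  rw [hb₂, hb₄, hb₆] at hc
  have hfac : (z - (-1)) * (4 * z ^ 2 + (-3) * z + 9) = 0 := by linear_combination hc
  rcases mul_eq_zero.mp hfac with h | h
  · linarith
  · nlinarith [sq_nonneg (8 * z + (-3))]
/-- **`(-1, 0)` is "odd"**: the only real root of the `2`-division cubic. [cite: GreenbergLNM1716, §5 Remark (chunk p0174)] -/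
theorem c30a1_odd : TwoTorsionOdd c30a1 (-1) := by
  intro r hr
  obtain ⟨hb₂, hb₄, hb₆⟩ := c30a1_b
  rw [hb₂, hb₄, hb₆] at hr
  push_cast at hr
  have hfac : (r - (-1)) * (4 * r ^ 2 + (-3) * r + 9) = 0 := by linear_combination hr
  rcases mul_eq_zero.mp hfac with h | h
  · push_cast; linarith
  · nlinarith [sq_nonneg (8 * r + (-3))]
/-- `2 ∣ #Ẽ(𝔽_ℓ)` for `30a1` at every good odd prime `ℓ` (a rational `2`-torsion point). [cite: SilvermanAEC2009, VII.3.1(b)] -/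
theorem two_dvd_reductionPointCount_30a1 {ℓ : ℕ} [Fact ℓ.Prime] (hℓ : 3 ≤ ℓ)
    (hΔ : ¬ (ℓ : ℤ) ∣ (-2160 : ℤ)) : 2 ∣ c30a1.reductionPointCount ℓ :=
  two_dvd_reductionPointCount_of_hasRationalTwoTorsionX ⟨0, c30a1_P⟩ hℓ
    (by rw [minimalDiscriminantInt_baseChange_int, M30a1_Δ]; exact hΔ)

/-- Cremona `46a1` = `[1, -1, 0, -10, -12]` (integer model). [cite: CremonaAlgorithms1997, Table 1] -/
abbrev M46a1 : WeierstrassCurve ℤ := ⟨1, -1, 0, -10, -12⟩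
/-- `46a1 / ℚ`. [cite: CremonaAlgorithms1997, Table 1] -/
abbrev c46a1 : WeierstrassCurve ℚ := M46a1.baseChange ℚ
/-- `Δ(46a1)` (factorisation `{2: 10, 23: 1}`, negative). [cite: CremonaAlgorithms1997, Table 1] -/
theorem M46a1_Δ : M46a1.Δ = -23552 := by decide
/-- `c₄(46a1)` (coprime to `Δ`: semistable model). [cite: CremonaAlgorithms1997, Table 1] -/
theorem M46a1_c₄ : M46a1.c₄ = 489 := by decide
/-- `46a1` is an elliptic curve. [cite: CremonaAlgorithms1997, Table 1] -/
instance c46a1_isElliptic : c46a1.IsElliptic := by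
  rw [WeierstrassCurve.isElliptic_iff, baseChange_int_Δ, M46a1_Δ]; norm_num
/-- Cremona's model `46a1` is globally minimal (`gcd(Δ, c₄) = 1`). [cite: SilvermanAEC2009, VII.1 Remark 1.1] -/
instance c46a1_isGloballyMinimal : c46a1.IsGloballyMinimal :=
  isGloballyMinimal_baseChange_int_of_gcd_eq_one 1 (-1) 0 (-10) (-12) (by decide)
/-- `Δ(46a1)`, `c₄(46a1)` coprime. [cite: SilvermanAEC2009, VII.5 Prop. 5.1(b)] -/
theorem M46a1_coprime : IsCoprime M46a1.Δ M46a1.c₄ := by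
  rw [M46a1_Δ, M46a1_c₄, Int.isCoprime_iff_gcd_eq_one]; decide
/-- **`46a1` is multiplicative at `2`** (`2 ∣ Δ`, `2 ∤ c₄`). [cite: SilvermanAEC2009, VII.5 Prop. 5.1(b)] -/
theorem mult_two_46a1 : Mult c46a1 2 := by
  have hgen : Rat.HeightOneSpectrum.natGenerator
      ((Rat.HeightOneSpectrum.primesEquiv (R := ℤ)).symm ⟨2, Nat.prime_two⟩) = 2 :=
    Literature.NumberTheory.EllipticCurves.Rat.natGenerator_primesEquiv_symm ⟨2, Nat.prime_two⟩
  have hm := hasMultiplicativeReductionAt_baseChange_int_of_isCoprime M46a1 M46a1_coprime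
    (v := (Rat.HeightOneSpectrum.primesEquiv (R := ℤ)).symm ⟨2, Nat.prime_two⟩)
    (by rw [hgen, M46a1_Δ]; decide)
  exact (hasMultiplicativeReductionAtPrime_iff_hasMultiplicativeReductionAt_holds c46a1
    ⟨2, Nat.prime_two⟩).mpr hm
/-- `46a1 mod 2`. [folklore] -/
theorem M46a1_mod_two : M46a1.map (Int.castRingHom (ZMod 2)) = ⟨1, 1, 0, 0, 0⟩ := by
  ext <;> decide
/-- **`46a1` is NON-SPLIT multiplicative at `2`** (node quadratic `X² + X + 1` has no root in `𝔽₂`).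
[cite: SilvermanAEC2009, VII.5 Prop. 5.1(b)] -/
theorem not_split_two_46a1 : ¬ c46a1.HasSplitMultiplicativeReductionAtPrime 2 := by
  have hint : integralModelInt c46a1 = M46a1 := integralModelInt_baseChange_int M46a1
  have hΔ : ((2 : ℕ) : ℤ) ∣ (integralModelInt c46a1).Δ := by rw [hint, M46a1_Δ]; decide
  have hc₄ : ¬ ((2 : ℕ) : ℤ) ∣ (integralModelInt c46a1).c₄ := by rw [hint, M46a1_c₄]; decide
  rw [LocalTorsionMult.hasSplitMultiplicativeReductionAtPrime_iff_splits_integralModelInt c46a1 2 hΔ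
    hc₄, hint, M46a1_mod_two]
  dsimp only
  rw [sub_eq_add_neg, ← Polynomial.C_neg]
  exact not_splits_quadratic_F2 (by decide) (by decide) (by decide)
/-- **The conductor of `46a1` is `46`** (semistable; Silverman ATAEC IV.10.2). [cite: CremonaAlgorithms1997, Table 1] -/
theorem conductorNorm_46a1 : c46a1.conductorNorm ℤ = 46 := by
  refine conductorNorm_baseChange_int_of_isCoprime M46a1 M46a1_coprime (k := 10) ?_ ?_ ?_
  · rw [Nat.squarefree_iff_nodup_primeFactorsList (by norm_num)]; simp
  · rw [M46a1_Δ]; decide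
  · rw [M46a1_Δ]; decide
/-- The coefficients of `46a1 / ℚ` (unfolded). [cite: CremonaAlgorithms1997, Table 1] -/
theorem c46a1_eq : c46a1 = ⟨1, -1, 0, -10, -12⟩ := by
  rw [c46a1, baseChange_int_eq]; norm_num
/-- `b₂, b₄, b₆` of `46a1`; `2`-division cubic `= (x − (4))(4x² + (13)x + (12))`. [cite: SilvermanAEC2009, III.1] -/
theorem c46a1_b : c46a1.b₂ = -3 ∧ c46a1.b₄ = -20 ∧ c46a1.b₆ = -48 := by
  rw [c46a1_eq]
  simp only [WeierstrassCurve.b₂, WeierstrassCurve.b₄, WeierstrassCurve.b₆]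
  norm_num
/-- The rational point `(4, -2)` of order `2` on `46a1`. [cite: CremonaAlgorithms1997, Table 1] -/
theorem c46a1_P : c46a1.toAffine.Equation 4 (-2) ∧
    2 * ((-2) : ℚ) + c46a1.a₁ * 4 + c46a1.a₃ = 0 := by
  rw [c46a1_eq, WeierstrassCurve.Affine.equation_iff]; norm_num
/-- **`(4, -2)` is the ONLY rational point of order `2` on `46a1`** (cofactor of negative discriminant).
[cite: SilvermanAEC2009, III.2.3] -/
theorem c46a1_unique : HasUniqueRationalTwoTorsionX c46a1 4 := by
  refine ⟨⟨(-2), c46a1_P⟩, fun z hz ↦ ?_⟩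
  have hc := cubic_eq_zero_of_hasRationalTwoTorsionX hz
  obtain ⟨hb₂, hb₄, hb₆⟩ := c46a1_b
  rw [hb₂, hb₄, hb₆] at hc
  have hfac : (z - 4) * (4 * z ^ 2 + 13 * z + 12) = 0 := by linear_combination hc
  rcases mul_eq_zero.mp hfac with h | h
  · linarith
  · nlinarith [sq_nonneg (8 * z + 13)]
/-- **`(4, -2)` is "odd"**: the only real root of the `2`-division cubic. [cite: GreenbergLNM1716, §5 Remark (chunk p0174)] -/
theorem c46a1_odd : TwoTorsionOdd c46a1 4 := by
  intro r hr
  obtain ⟨hb₂, hb₄, hb₆⟩ := c46a1_b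
  rw [hb₂, hb₄, hb₆] at hr
  push_cast at hr
  have hfac : (r - 4) * (4 * r ^ 2 + 13 * r + 12) = 0 := by linear_combination hr
  rcases mul_eq_zero.mp hfac with h | h
  · push_cast; linarith
  · nlinarith [sq_nonneg (8 * r + 13)]
/-- `2 ∣ #Ẽ(𝔽_ℓ)` for `46a1` at every good odd prime `ℓ` (a rational `2`-torsion point). [cite: SilvermanAEC2009, VII.3.1(b)] -/
theorem two_dvd_reductionPointCount_46a1 {ℓ : ℕ} [Fact ℓ.Prime] (hℓ : 3 ≤ ℓ)
    (hΔ : ¬ (ℓ : ℤ) ∣ (-23552 : ℤ)) : 2 ∣ c46a1.reductionPointCount ℓ :=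
  two_dvd_reductionPointCount_of_hasRationalTwoTorsionX ⟨(-2), c46a1_P⟩ hℓ
    (by rw [minimalDiscriminantInt_baseChange_int, M46a1_Δ]; exact hΔ)

/-- Cremona `142c1` = `[1, -1, 0, -1, -3]` (integer model). [cite: CremonaAlgorithms1997, Table 1] -/
abbrev M142c1 : WeierstrassCurve ℤ := ⟨1, -1, 0, -1, -3⟩
/-- `142c1 / ℚ`. [cite: CremonaAlgorithms1997, Table 1] -/
abbrev c142c1 : WeierstrassCurve ℚ := M142c1.baseChange ℚ
/-- `Δ(142c1)` (factorisation `{2: 6, 71: 1}`, negative). [cite: CremonaAlgorithms1997, Table 1] -/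
theorem M142c1_Δ : M142c1.Δ = -4544 := by decide
/-- `c₄(142c1)` (coprime to `Δ`: semistable model). [cite: CremonaAlgorithms1997, Table 1] -/
theorem M142c1_c₄ : M142c1.c₄ = 57 := by decide
/-- `142c1` is an elliptic curve. [cite: CremonaAlgorithms1997, Table 1] -/
instance c142c1_isElliptic : c142c1.IsElliptic := by
  rw [WeierstrassCurve.isElliptic_iff, baseChange_int_Δ, M142c1_Δ]; norm_num
/-- Cremona's model `142c1` is globally minimal (`gcd(Δ, c₄) = 1`). [cite: SilvermanAEC2009, VII.1 Remark 1.1] -/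
instance c142c1_isGloballyMinimal : c142c1.IsGloballyMinimal :=
  isGloballyMinimal_baseChange_int_of_gcd_eq_one 1 (-1) 0 (-1) (-3) (by decide)
/-- `Δ(142c1)`, `c₄(142c1)` coprime. [cite: SilvermanAEC2009, VII.5 Prop. 5.1(b)] -/
theorem M142c1_coprime : IsCoprime M142c1.Δ M142c1.c₄ := by
  rw [M142c1_Δ, M142c1_c₄, Int.isCoprime_iff_gcd_eq_one]; decide
/-- **`142c1` is multiplicative at `2`** (`2 ∣ Δ`, `2 ∤ c₄`). [cite: SilvermanAEC2009, VII.5 Prop. 5.1(b)] -/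
theorem mult_two_142c1 : Mult c142c1 2 := by
  have hgen : Rat.HeightOneSpectrum.natGenerator
      ((Rat.HeightOneSpectrum.primesEquiv (R := ℤ)).symm ⟨2, Nat.prime_two⟩) = 2 :=
    Literature.NumberTheory.EllipticCurves.Rat.natGenerator_primesEquiv_symm ⟨2, Nat.prime_two⟩
  have hm := hasMultiplicativeReductionAt_baseChange_int_of_isCoprime M142c1 M142c1_coprime
    (v := (Rat.HeightOneSpectrum.primesEquiv (R := ℤ)).symm ⟨2, Nat.prime_two⟩)
    (by rw [hgen, M142c1_Δ]; decide)
  exact (hasMultiplicativeReductionAtPrime_iff_hasMultiplicativeReductionAt_holds c142c1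
    ⟨2, Nat.prime_two⟩).mpr hm
/-- `142c1 mod 2`. [folklore] -/
theorem M142c1_mod_two : M142c1.map (Int.castRingHom (ZMod 2)) = ⟨1, 1, 0, 1, 1⟩ := by
  ext <;> decide
/-- **`142c1` is NON-SPLIT multiplicative at `2`** (node quadratic `X² + X + 1` has no root in `𝔽₂`).
[cite: SilvermanAEC2009, VII.5 Prop. 5.1(b)] -/
theorem not_split_two_142c1 : ¬ c142c1.HasSplitMultiplicativeReductionAtPrime 2 := by
  have hint : integralModelInt c142c1 = M142c1 := integralModelInt_baseChange_int M142c1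
  have hΔ : ((2 : ℕ) : ℤ) ∣ (integralModelInt c142c1).Δ := by rw [hint, M142c1_Δ]; decide
  have hc₄ : ¬ ((2 : ℕ) : ℤ) ∣ (integralModelInt c142c1).c₄ := by rw [hint, M142c1_c₄]; decide
  rw [LocalTorsionMult.hasSplitMultiplicativeReductionAtPrime_iff_splits_integralModelInt c142c1 2 hΔ
    hc₄, hint, M142c1_mod_two]
  dsimp only
  rw [sub_eq_add_neg, ← Polynomial.C_neg]
  exact not_splits_quadratic_F2 (by decide) (by decide) (by decide)
/-- **The conductor of `142c1` is `142`** (semistable; Silverman ATAEC IV.10.2). [cite: CremonaAlgorithms1997, Table 1] -/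
theorem conductorNorm_142c1 : c142c1.conductorNorm ℤ = 142 := by
  refine conductorNorm_baseChange_int_of_isCoprime M142c1 M142c1_coprime (k := 6) ?_ ?_ ?_
  · rw [Nat.squarefree_iff_nodup_primeFactorsList (by norm_num)]; simp
  · rw [M142c1_Δ]; decide
  · rw [M142c1_Δ]; decide
/-- The coefficients of `142c1 / ℚ` (unfolded). [cite: CremonaAlgorithms1997, Table 1] -/
theorem c142c1_eq : c142c1 = ⟨1, -1, 0, -1, -3⟩ := by
  rw [c142c1, baseChange_int_eq]; norm_num
/-- `b₂, b₄, b₆` of `142c1`; `2`-division cubic `= (x − (2))(4x² + (5)x + (6))`. [cite: SilvermanAEC2009, III.1] -/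
theorem c142c1_b : c142c1.b₂ = -3 ∧ c142c1.b₄ = -2 ∧ c142c1.b₆ = -12 := by
  rw [c142c1_eq]
  simp only [WeierstrassCurve.b₂, WeierstrassCurve.b₄, WeierstrassCurve.b₆]
  norm_num
/-- The rational point `(2, -1)` of order `2` on `142c1`. [cite: CremonaAlgorithms1997, Table 1] -/
theorem c142c1_P : c142c1.toAffine.Equation 2 (-1) ∧
    2 * ((-1) : ℚ) + c142c1.a₁ * 2 + c142c1.a₃ = 0 := by
  rw [c142c1_eq, WeierstrassCurve.Affine.equation_iff]; norm_num
/-- **`(2, -1)` is the ONLY rational point of order `2` on `142c1`** (cofactor of negative discriminant).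
[cite: SilvermanAEC2009, III.2.3] -/
theorem c142c1_unique : HasUniqueRationalTwoTorsionX c142c1 2 := by
  refine ⟨⟨(-1), c142c1_P⟩, fun z hz ↦ ?_⟩
  have hc := cubic_eq_zero_of_hasRationalTwoTorsionX hz
  obtain ⟨hb₂, hb₄, hb₆⟩ := c142c1_b
  rw [hb₂, hb₄, hb₆] at hc
  have hfac : (z - 2) * (4 * z ^ 2 + 5 * z + 6) = 0 := by linear_combination hc
  rcases mul_eq_zero.mp hfac with h | h
  · linarith
  · nlinarith [sq_nonneg (8 * z + 5)]
/-- **`(2, -1)` is "odd"**: the only real root of the `2`-division cubic. [cite: GreenbergLNM1716, §5 Remark (chunk p0174)] -/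
theorem c142c1_odd : TwoTorsionOdd c142c1 2 := by
  intro r hr
  obtain ⟨hb₂, hb₄, hb₆⟩ := c142c1_b
  rw [hb₂, hb₄, hb₆] at hr
  push_cast at hr
  have hfac : (r - 2) * (4 * r ^ 2 + 5 * r + 6) = 0 := by linear_combination hr
  rcases mul_eq_zero.mp hfac with h | h
  · push_cast; linarith
  · nlinarith [sq_nonneg (8 * r + 5)]
/-- `2 ∣ #Ẽ(𝔽_ℓ)` for `142c1` at every good odd prime `ℓ` (a rational `2`-torsion point). [cite: SilvermanAEC2009, VII.3.1(b)] -/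
theorem two_dvd_reductionPointCount_142c1 {ℓ : ℕ} [Fact ℓ.Prime] (hℓ : 3 ≤ ℓ)
    (hΔ : ¬ (ℓ : ℤ) ∣ (-4544 : ℤ)) : 2 ∣ c142c1.reductionPointCount ℓ :=
  two_dvd_reductionPointCount_of_hasRationalTwoTorsionX ⟨(-1), c142c1_P⟩ hℓ
    (by rw [minimalDiscriminantInt_baseChange_int, M142c1_Δ]; exact hΔ)

end Summit.BirchSwinnertonDyer.Rank1Residual.X5.Instances
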